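import Summits.FinalStateConjecture.FinalStateConjecture.Theorems.PhaseMixingCaptureNearExtremalKappaCaptureFaceRedShiftAlgebra

/-!
# Red-shift on the face collar of near-extremal Kerr — II: absorption of the off-horizon errors

Helper file for the stub `stub_faceRedShift` (S2) of the line `unit-temperature-front-face` for the
crux `NearExtremalKappaCapture` (route `PhaseMixingCapture`, item stmt-FinalStateConjecture-10606);
sequel of `…FaceRedShiftAlgebra.lean`.

With `p = dw(x)`, `λ = p(K)`, `v = p(k)`, `Q = |q̸|²` (`q = p + v dr`), `A = q̸·∇̸r`, the exact bulk
of the red-shift multiplier `N = (1 + h(r − r₊))(K + k)` (`Kerr.multiplierBulk_redShiftVector`,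
`h₁ = f₁ = h`) reads, after the substitutions `u = 2R + (e2 + Dr)v − 2A` (`R = g⁻¹(p, dr)`,
`e2 = Δ/Σ`, `Dr = |∇̸r|²`) and `R = 2Hλ + D`, `D = e2(λ − v) + e1·Π` (`Π = x₁p₂ − x₂p₁`,
`e1 = (a − (r² + a²)ω₊)/Σ`),
`K^N = Main + e2·X + e1·Π·W`, where `Main` is the horizon-shaped form of
`main_form_lower` with transversal coefficient `Rt = −∂_ℓH − (r/Σ)Dr`, `Σ·Rt = (r − M) − rΔ/Σ`, and
`X`, `W` are an explicit quadratic resp. linear form in `(λ, v)`. On the collar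
`|r − (M + s)| ≤ s/5000` (`s = √(M² − a²)`, `h = 64/s`): `|e2| ≤ s²/(2000Σ)`, `|e1| ≤ s/(4000Σ)`,
`Σ·Rt ≥ 0.999 s`, `cf = 1 + h(r − r₊) ∈ [0.98, 1.02]`, and the two error terms cost at most a
`10⁻¹`-fraction of the three budgets `λ²/s`, `Q/s`, `(s/Σ)v²` (`collar_e2X_bound`,
`collar_e1PW_bound`); `collar_algebra` assembles the pointwise inequality
`(κ/32)(λ² + v² + Q) ≤ K^N`, `κ = s/(2M r₊)`, as a statement about real numbers whose hypotheses
are exactly the point identities supplied by the geometric file.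
-/

noncomputable section

-- the doubled `FinalStateConjecture.FinalStateConjecture` path component trips dupNamespace
set_option linter.dupNamespace false

namespace Summit.FinalStateConjecture.FinalStateConjecture.Theorems.NearExtremalKappaCapture.UnitTemperatureFrontFace

/-! ### Absorption of the off-horizon error terms -/

/-- The `Δ`-error `e2 · X`, `X = hλ² − (h + 2 cf r/Σ) λv + (cf r/Σ − h/2) v²` (`h = 64/s`), costs at
most `195/4000 · λ²/s + 135/4000 · (s/Σ) v²` on the collar (`|e2| = |Δ|/Σ ≤ s²/(2000Σ)`). -/
theorem collar_e2X_bound {s S r cf e2 lam v : ℝ} (hs : 0 < s) (hS0 : 0 < S) (hsS : s ^ 2 ≤ S)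
    (he2 : |e2| ≤ s ^ 2 / (2000 * S)) (hcf1 : cf ≤ 3 / 2) (hcfnn : 0 ≤ cf)
    (hrS' : r / S ≤ 1 / s) (hrS0 : 0 ≤ r / S) :
    -(195 / 4000 * (1 / s * lam ^ 2) + 135 / 4000 * (s / S * v ^ 2)) ≤
      e2 * (64 / s * lam ^ 2 + (-(64 / s) - 2 * cf * (r / S)) * (lam * v) +
        (cf * (r / S) - 32 / s) * v ^ 2) := by
  have h64 : (0 : ℝ) < 64 / s := div_pos (by norm_num) hs
  have h1 : cf * (r / S) ≤ 3 / 2 * (1 / s) := mul_le_mul hcf1 hrS' hrS0 (by norm_num)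
  have h2 : 0 ≤ cf * (r / S) := mul_nonneg hcfnn hrS0
  have hβ : |-(64 / s) - 2 * cf * (r / S)| ≤ 67 / s := by
    rw [abs_of_nonpos (by linarith)]
    simp only [div_eq_mul_inv] at h1 ⊢
    linarith
  have hγ : |cf * (r / S) - 32 / s| ≤ 34 / s := by
    have h3 : 0 < s⁻¹ := inv_pos.2 hs
    simp only [div_eq_mul_inv] at h1 h2 ⊢
    rw [abs_le]; constructor <;> linarith
  have hX := abs_quad_le (lam := lam) (v := v) h64.le hβ hγ
  have hXb : |64 / s * lam ^ 2 + (-(64 / s) - 2 * cf * (r / S)) * (lam * v) +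
      (cf * (r / S) - 32 / s) * v ^ 2| ≤ (195 * lam ^ 2 + 135 * v ^ 2) / (2 * s) := by
    refine hX.trans ?_
    have y3 : 2 * (|lam| * |v|) ≤ lam ^ 2 + v ^ 2 := by
      nlinarith [sq_nonneg (|lam| - |v|), sq_abs lam, sq_abs v]
    rw [← sub_nonneg]
    have key : (195 * lam ^ 2 + 135 * v ^ 2) / (2 * s) -
        (64 / s * lam ^ 2 + 67 / s * (|lam| * |v|) + 34 / s * v ^ 2) =
        67 * (lam ^ 2 + v ^ 2 - 2 * (|lam| * |v|)) / (2 * s) := by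
      field_simp; ring
    rw [key]
    exact div_nonneg (by linarith) (mul_pos (by norm_num) hs).le
  have hE := neg_mul_le_mul_of_abs_le he2 hXb
  have c1 : s ^ 2 / (2000 * S) * ((195 * lam ^ 2 + 135 * v ^ 2) / (2 * s)) =
      195 / 4000 * (s / S * lam ^ 2) + 135 / 4000 * (s / S * v ^ 2) := by
    field_simp; ring
  have f4 : s / S * lam ^ 2 ≤ 1 / s * lam ^ 2 := by
    refine mul_le_mul_of_nonneg_right ?_ (sq_nonneg _)
    rw [div_le_div_iff₀ hS0 hs]; nlinarith
  rw [c1] at hE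
  linarith

/-- The `K`-misalignment error `e1 · Π · W`, `W = hλ − 2 cf (r/Σ) v`, costs at most
`134/4000 · Q/s + 195/4000 · λ²/s + 6/4000 · (s/Σ) v²` on the collar
(`|e1| ≤ s/(4000Σ)`, `|Π| ≤ 2|B| + 2M|λ|`, `B² ≤ 2ΣQ`). -/
theorem collar_e1PW_bound {M s S r cf e1 lam v Q B Pi : ℝ} (hM : 0 < M) (hs : 0 < s)
    (hsM : s ≤ M) (hMS : M ^ 2 ≤ S) (hQ : 0 ≤ Q) (hB2 : B ^ 2 ≤ 2 * S * Q)
    (hPi' : |Pi| ≤ 2 * |B| + 2 * M * |lam|) (he1 : |e1| ≤ s / (4000 * S))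
    (hcf1 : cf ≤ 3 / 2) (hcfnn : 0 ≤ cf) (hrS : r / S ≤ 1 / M) (hrS0 : 0 ≤ r / S) :
    -(134 / 4000 * (1 / s * Q) + 195 / 4000 * (1 / s * lam ^ 2) + 6 / 4000 * (s / S * v ^ 2)) ≤
      e1 * (Pi * (64 / s * lam + -(2 * cf * (r / S)) * v)) := by
  have hS0 : 0 < S := lt_of_lt_of_le (by positivity) hMS
  have h64 : (0 : ℝ) < 64 / s := div_pos (by norm_num) hs
  have hδ : |-(2 * cf * (r / S))| ≤ 3 / M := by
    have h1 : cf * (r / S) ≤ 3 / 2 * (1 / M) := mul_le_mul hcf1 hrS hrS0 (by norm_num)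
    have h2 : 0 ≤ cf * (r / S) := mul_nonneg hcfnn hrS0
    rw [abs_neg, abs_of_nonneg (by linarith)]
    simp only [div_eq_mul_inv] at h1 ⊢
    linarith
  have hW := abs_lin_le (lam := lam) (v := v) (le_of_eq (abs_of_pos h64)) hδ
  have hPnn : 0 ≤ 2 * |B| + 2 * M * |lam| := by positivity
  have hprod : |Pi| * |64 / s * lam + -(2 * cf * (r / S)) * v| ≤
      (2 * |B| + 2 * M * |lam|) * (64 / s * |lam| + 3 / M * |v|) :=
    mul_le_mul hPi' hW (abs_nonneg _) hPnn
  have hPW : |Pi * (64 / s * lam + -(2 * cf * (r / S)) * v)| ≤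
      (134 * S * Q + 195 * S * lam ^ 2) / s ^ 2 + 6 * v ^ 2 := by
    rw [abs_mul]
    exact hprod.trans (prod_PW_le hM hs hsM hMS hQ hB2)
  have hE := neg_mul_le_mul_of_abs_le he1 hPW
  have c2 : s / (4000 * S) * ((134 * S * Q + 195 * S * lam ^ 2) / s ^ 2 + 6 * v ^ 2) =
      134 / 4000 * (1 / s * Q) + 195 / 4000 * (1 / s * lam ^ 2) + 6 / 4000 * (s / S * v ^ 2) := by
    field_simp
  rw [c2] at hE
  exact hE

/-- The transversal coefficient stays comparable to its horizon value on the collar: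
`Σ · Rt = (r − M) − r e2 ≥ 0.999 s`. -/
theorem collar_SRt_lb {M s S r e2 : ℝ} (hs : 0 < s) (hr0 : 0 < r) (hS0 : 0 < S)
    (he2 : |e2| ≤ s ^ 2 / (2000 * S)) (hrS' : r / S ≤ 1 / s)
    (ht1 : -(1 / 10000 * (2 * s)) ≤ r - (M + s)) :
    999 / 1000 * s ≤ r - M - r * e2 := by
  have h1 : r * e2 ≤ s / 2000 := by
    calc r * e2 ≤ r * |e2| := mul_le_mul_of_nonneg_left (le_abs_self _) hr0.le
      _ ≤ r * (s ^ 2 / (2000 * S)) := mul_le_mul_of_nonneg_left he2 hr0.le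
      _ = r / S * (s ^ 2 / 2000) := by field_simp
      _ ≤ 1 / s * (s ^ 2 / 2000) := mul_le_mul_of_nonneg_right hrS' (by positivity)
      _ = s / 2000 := by field_simp
  linarith

/-- The coercivity constant: `κ/32 = s/(64M(M + s))` is below `1/(128 s)` and below `(3/32)(s/Σ)`
(`Σ ≤ 6M(M + s)` on the collar). -/
theorem collar_kappa_le {M s S : ℝ} (hM : 0 < M) (hs : 0 < s) (hsM : s ≤ M) (hS0 : 0 < S)
    (hS6 : S ≤ 6 * (M * (M + s))) :
    1 / 32 * (s / (2 * M * (M + s))) ≤ 1 / 128 * (1 / s) ∧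
      1 / 32 * (s / (2 * M * (M + s))) ≤ 3 / 32 * (s / S) := by
  have hMs : 0 < M + s := by linarith
  have hden : (0 : ℝ) < 64 * M * (M + s) := by positivity
  have hss : s * s ≤ M * s := mul_le_mul_of_nonneg_right hsM hs.le
  have hsM2 : s * s ≤ M * M := mul_le_mul hsM hsM hs.le hM.le
  have e0 : 1 / 32 * (s / (2 * M * (M + s))) = s / (64 * M * (M + s)) := by
    field_simp; ring
  have e1 : 1 / 128 * (1 / s) = 1 / (128 * s) := by field_simp
  have e2 : 3 / 32 * (s / S) = 3 * s / (32 * S) := by field_simp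
  constructor
  · rw [e0, e1, div_le_div_iff₀ hden (by positivity)]
    nlinarith
  · rw [e0, e2, div_le_div_iff₀ hden (by positivity)]
    nlinarith [mul_le_mul_of_nonneg_left hS6 hs.le]

/-- The final bookkeeping: main form minus error budget dominates `(κ/32)(λ² + v² + Q)`
(pure linear arithmetic in the budget monomials `λ²/s`, `Q/s`, `(s/Σ)v²`, `cf·Rt·v²`). -/
theorem collar_combine {is sS kap L V Qv CR Main EX EP : ℝ} (hL : 0 ≤ L) (hV : 0 ≤ V)
    (hQ : 0 ≤ Qv) (his : 0 ≤ is) (hsS : 0 ≤ sS)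
    (hMain : 16 * is * L + 8 * is * Qv + CR / 2 * V ≤ Main)
    (hEX : -(195 / 4000 * (is * L) + 135 / 4000 * (sS * V)) ≤ EX)
    (hEP : -(134 / 4000 * (is * Qv) + 195 / 4000 * (is * L) + 6 / 4000 * (sS * V)) ≤ EP)
    (f1 : 1 / 32 * kap * L ≤ 1 / 128 * is * L) (f2 : 1 / 32 * kap * Qv ≤ 1 / 128 * is * Qv)
    (f3 : 1 / 32 * kap * V ≤ 3 / 32 * sS * V) (f5 : 49 / 50 * (999 / 1000) * sS * V ≤ CR * V) :
    1 / 32 * kap * (L + V + Qv) ≤ Main + (EX + EP) := by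
  linarith [mul_nonneg his hL, mul_nonneg his hQ, mul_nonneg hsS hV]

/-- **The collar algebra.** At a point of the collar `|r − r₊| ≤ 10⁻⁴ (r₊ − r₋)` of a
sub-extremal Kerr black hole (`s = √(M² − a²) > 0`, `a² + s² = M²`, `r₊ = M + s`), given the point
identities for `Dr = |∇̸r|²`, `H = Mr/Σ`, `∂_ℓH`, the Cauchy–Schwarz bounds `A² ≤ Q·Dr`,
`B² ≤ (r² + a²)Q`, the axial relation `Π(1 − cω₊) = B − cλ` (`c² ≤ a²`), the component formula for
`R = g⁻¹(p, dr)` and the frame formula for `u = p(m)`, the bulk of the red-shift multiplier with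
`h₁ = f₁ = 64/s` dominates `(κ/32)(λ² + v² + Q)`, `κ = s/(2Mr₊)`. -/
theorem collar_algebra :
    ∀ {M s r S a c H Hl Dr R u lam v Q A B Pi om h kap rp : ℝ}, 0 < M → 0 < s → s ≤ M →
      a ^ 2 + s ^ 2 = M ^ 2 → rp = M + s → |r - rp| ≤ 1 / 10000 * (2 * s) → r ^ 2 ≤ S →
      Dr = (r ^ 2 + a ^ 2 - S) / S → 0 ≤ Dr → H = M * r / S → Hl = M * (S - 2 * r ^ 2) / S ^ 2 →
      0 ≤ Q → A ^ 2 ≤ Q * Dr → B ^ 2 ≤ (r ^ 2 + a ^ 2) * Q → c ^ 2 ≤ a ^ 2 →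
      om = a / (2 * M * rp) → Pi * (1 - c * om) = B - c * lam →
      R = 2 * H * v + (a * Pi + (r ^ 2 + a ^ 2) * (lam - om * Pi - v)) / S →
      u = 2 * R + ((r ^ 2 - 2 * M * r + a ^ 2) / S + Dr) * v - 2 * A →
      h = 64 / s → kap = s / (2 * M * rp) →
      1 / 32 * kap * (lam ^ 2 + v ^ 2 + Q) ≤
        h * R * lam + h * (2⁻¹ * Q - 2⁻¹ * ((r ^ 2 - 2 * M * r + a ^ 2) / S) * v ^ 2) -
          (1 + h * (r - rp)) * (r / S * (u * v) + Hl * v ^ 2) := by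
  intro M s r S a c H Hl Dr R u lam v Q A B Pi om h kap rp hM hs hsM has hrp ht hS1 hDr hDr0 hH hHl hQ
    hA hB hc hom hPi hR hu hh hkap
  subst hrp hkap hh hu hHl hom
  obtain ⟨ht1, ht2⟩ := abs_le.1 ht
  -- positivity and size facts on the collar
  have hMs : 0 < M + s := by linarith
  have ha2 : a ^ 2 ≤ M ^ 2 := by linarith [sq_nonneg s]
  have hrM : M ≤ r := by linarith
  have hr0 : 0 < r := hM.trans_le hrM
  have hrup : r ≤ M + s + s / 5000 := by linarith
  have hS0 : 0 < S := lt_of_lt_of_le (by positivity) hS1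
  have hMS : M ^ 2 ≤ S := le_trans (pow_le_pow_left₀ hM.le hrM 2) hS1
  have hsS : s ^ 2 ≤ S := le_trans (pow_le_pow_left₀ hs.le hsM 2) hMS
  have hS2 : S ≤ r ^ 2 + a ^ 2 := by
    rw [hDr, le_div_iff₀ hS0] at hDr0; linarith
  have hDr1 : Dr ≤ 1 := by
    rw [hDr, div_le_one hS0]; linarith
  have h2S : r ^ 2 + a ^ 2 ≤ 2 * S := by linarith
  have hB2 : B ^ 2 ≤ 2 * S * Q :=
    le_trans hB (by have := mul_le_mul_of_nonneg_right h2S hQ; linarith)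
  have hrr : M * r ≤ r * r := mul_le_mul_of_nonneg_right hrM hr0.le
  have hrS : r / S ≤ 1 / M := by
    rw [div_le_div_iff₀ hS0 hM]; linarith
  have hrS' : r / S ≤ 1 / s := hrS.trans (one_div_le_one_div_of_le hs hsM)
  have hrS0 : 0 ≤ r / S := by positivity
  have hr2 : r * r ≤ r * (M + s + s / 5000) := mul_le_mul_of_nonneg_left hrup hr0.le
  have hrs : r * s ≤ r * M := mul_le_mul_of_nonneg_left hsM hr0.le
  have hM2 : M * M ≤ M * r := mul_le_mul_of_nonneg_left hrM hM.le
  have hr3 : r * (M + s + s / 5000) ≤ (M + s + s / 5000) * (M + s + s / 5000) :=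
    mul_le_mul_of_nonneg_right hrup (by positivity)
  have hss : s * s ≤ M * s := mul_le_mul_of_nonneg_right hsM hs.le
  have hS6 : S ≤ 6 * (M * (M + s)) := by linarith
  -- the Kerr–Schild scalar `H = Mr/Σ ∈ [1/4, 5/4]`
  have hH0 : 1 / 4 ≤ H := by
    rw [hH, le_div_iff₀ hS0]; linarith
  have hH1 : H ≤ 5 / 4 := by
    rw [hH, div_le_iff₀ hS0]; linarith
  -- the two small coefficients `e2 = Δ/Σ`, `e1 = (a − (r² + a²)ω₊)/Σ`
  have he2 : |(r ^ 2 - 2 * M * r + a ^ 2) / S| ≤ s ^ 2 / (2000 * S) := by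
    rw [abs_div, abs_of_pos hS0]
    calc |r ^ 2 - 2 * M * r + a ^ 2| / S ≤ s ^ 2 / 2000 / S :=
          div_le_div_of_nonneg_right (abs_delta_le hs has ht) hS0.le
      _ = s ^ 2 / (2000 * S) := by rw [div_div]
  have he1 : |(a - (r ^ 2 + a ^ 2) * (a / (2 * M * (M + s)))) / S| ≤ s / (4000 * S) := by
    rw [abs_div, abs_of_pos hS0]
    calc |a - (r ^ 2 + a ^ 2) * (a / (2 * M * (M + s)))| / S ≤ s / 4000 / S :=
          div_le_div_of_nonneg_right (abs_eps1_num_le hM hs has ht) hS0.le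
      _ = s / (4000 * S) := by rw [div_div]
  have hPi' : |Pi| ≤ 2 * |B| + 2 * M * |lam| := abs_Pi_le hM hs has hc rfl hPi
  -- the weight `cf = 1 + h (r − r₊) ∈ [49/50, 51/50]`
  have hcfu : 64 / s * (r - (M + s)) ≤ 1 / 50 := by
    have h1 : 64 / s * (r - (M + s)) ≤ 64 / s * (1 / 10000 * (2 * s)) :=
      mul_le_mul_of_nonneg_left ht2 (by positivity)
    have h2 : 64 / s * (1 / 10000 * (2 * s)) = 64 / 5000 := by field_simp; ring
    linarith
  have hcfl : -(1 / 50) ≤ 64 / s * (r - (M + s)) := by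
    have h1 : 64 / s * (-(1 / 10000 * (2 * s))) ≤ 64 / s * (r - (M + s)) :=
      mul_le_mul_of_nonneg_left (by linarith) (by positivity)
    have h2 : 64 / s * (-(1 / 10000 * (2 * s))) = -(64 / 5000) := by field_simp; ring
    linarith
  obtain ⟨cf, hcf⟩ : ∃ cf : ℝ, cf = 1 + 64 / s * (r - (M + s)) := ⟨_, rfl⟩
  rw [← hcf]
  have hcf0 : 1 / 2 ≤ cf := by rw [hcf]; linarith
  have hcf1 : cf ≤ 3 / 2 := by rw [hcf]; linarith
  have hcf49 : 49 / 50 ≤ cf := by rw [hcf]; linarith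
  have hcfnn : 0 ≤ cf := by linarith
  clear hcf hcfu hcfl
  -- the transversal coefficient `Rt = −∂_ℓH − (r/Σ)|∇̸r|²`, `Σ Rt = (r − M) − r Δ/Σ ≥ 0.999 s`
  obtain ⟨Rt, hRt⟩ : ∃ Rt : ℝ, Rt = -(M * (S - 2 * r ^ 2) / S ^ 2) - r / S * Dr := ⟨_, rfl⟩
  have hSRt : S * Rt = (r - M) - r * ((r ^ 2 - 2 * M * r + a ^ 2) / S) := by
    rw [hRt, hDr]; field_simp; ring
  have hSRt_lb : 999 / 1000 * s ≤ S * Rt := by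
    rw [hSRt]; exact collar_SRt_lb hs hr0 hS0 he2 hrS' ht1
  have hSRt_pos : 0 < S * Rt := by linarith
  have hRt0 : 0 < Rt := pos_of_mul_pos_right hSRt_pos hS0.le
  have hRt_lb : 999 / 1000 * (s / S) ≤ Rt := by
    rw [mul_div_assoc', div_le_iff₀ hS0]; linarith
  have hthr : 32 ≤ 64 / s * (S * Rt) := by
    have h1 : 64 / s * (999 / 1000 * s) ≤ 64 / s * (S * Rt) :=
      mul_le_mul_of_nonneg_left hSRt_lb (by positivity)
    have h2 : 64 / s * (999 / 1000 * s) = 64 * 999 / 1000 := by field_simp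
    linarith
  -- decompose `R = 2Hλ + D`, `D = e2 (λ − v) + e1 Π`
  obtain ⟨D, rfl⟩ : ∃ D, R = 2 * H * lam + D := ⟨R - 2 * H * lam, by ring⟩
  have hDe : D = (r ^ 2 - 2 * M * r + a ^ 2) / S * (lam - v) +
      (a - (r ^ 2 + a ^ 2) * (a / (2 * M * (M + s)))) / S * Pi := by
    have hD' : D = 2 * H * v + (a * Pi + (r ^ 2 + a ^ 2) *
        (lam - a / (2 * M * (M + s)) * Pi - v)) / S - 2 * H * lam := by linarith
    rw [hD', hH]
    field_simp
    ring
  obtain ⟨e2, he2_def⟩ : ∃ e2 : ℝ, e2 = (r ^ 2 - 2 * M * r + a ^ 2) / S := ⟨_, rfl⟩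
  obtain ⟨e1, he1_def⟩ : ∃ e1 : ℝ, e1 = (a - (r ^ 2 + a ^ 2) * (a / (2 * M * (M + s)))) / S :=
    ⟨_, rfl⟩
  rw [← he2_def] at he2 hDe ⊢
  rw [← he1_def] at he1 hDe
  clear hR he2_def he1_def hSRt ht hSRt_lb hSRt_pos
  -- the main form and the two error terms
  have hMain := main_form_lower (H := H) (r := r) (lam := lam) (v := v) (A := A) (h := 64 / s)
    (f := 64 / s) hS0 hS1 hDr1 hQ hA hH0 hH1 hRt0 hcf0 hcf1 hthr (by linarith)
  have e16 : 64 / s / 4 = 16 * (1 / s) := by ring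
  have e8 : 64 / s / 8 = 8 * (1 / s) := by ring
  rw [e16, e8] at hMain
  have hE2X := collar_e2X_bound (lam := lam) (v := v) hs hS0 hsS he2 hcf1 hcfnn hrS' hrS0
  have hE1PW := collar_e1PW_bound (v := v) hM hs hsM hMS hQ hB2 hPi' he1 hcf1 hcfnn hrS hrS0
  -- the coercivity constant
  obtain ⟨hk1, hk2⟩ := collar_kappa_le hM hs hsM hS0 hS6
  have f1 := mul_le_mul_of_nonneg_right hk1 (sq_nonneg lam)
  have f2 := mul_le_mul_of_nonneg_right hk1 hQ
  have f3 := mul_le_mul_of_nonneg_right hk2 (sq_nonneg v)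
  have f5 : 49 / 50 * (999 / 1000) * (s / S) * v ^ 2 ≤ cf * Rt * v ^ 2 := by
    refine mul_le_mul_of_nonneg_right ?_ (sq_nonneg _)
    calc 49 / 50 * (999 / 1000) * (s / S) = 49 / 50 * (999 / 1000 * (s / S)) := by ring
      _ ≤ 49 / 50 * Rt := mul_le_mul_of_nonneg_left hRt_lb (by norm_num)
      _ ≤ cf * Rt := mul_le_mul_of_nonneg_right hcf49 hRt0.le
  -- assemble
  refine le_trans (collar_combine (sq_nonneg lam) (sq_nonneg v) hQ (by positivity) (by positivity)
    hMain hE2X hE1PW f1 f2 f3 f5)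
    (le_of_eq ?_)
  rw [hDe, hRt]
  ring

end Summit.FinalStateConjecture.FinalStateConjecture.Theorems.NearExtremalKappaCapture.UnitTemperatureFrontFace

end
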